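import Literature.NumberTheory.EllipticCurves.DivisionPointsTateUnitTransport
import Literature.NumberTheory.EllipticCurves.CMTransformationPairOfReps
import Literature.NumberTheory.EllipticCurves.DeShalit1987.RayClassFieldPAdicReading
import Literature.NumberTheory.EllipticCurves.DeShalit1987.CMFormalActionReadingSeries
import Literature.NumberTheory.EllipticCurves.DeShalit1987.CMFormalActionReadingIdentities
import Literature.NumberTheory.EllipticCurves.X049IntegralModelReadings
import Literature.NumberTheory.EllipticCurves.WeierstrassTorsion
import HarnessLib

/-!
# The `δ`-CM datum OVER THE `𝔓`-ADIC READING RING for a GENERAL multiplier `δ ∈ 𝓞_K` (a `v`-unit): the CM-datum binder block of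
# `tateUnit_eq_mul_of_cm_readings` / `…SeamTateUnitOfLane` instantiated at `R := 𝒪_{F,(𝔓)}` and discharged (TATE-UNIT-CM, OQ-A1; proofs only)

Cell `bsd-print-cf2`, width seat `bsd-line-cf2c-w4` g16.  The twin of cf2-p1-w7's `exists_cmDatum_readingRing` (the CM datum of the
uniformiser `π₀`, transformation pair from `CMTransformationPairSeven`) for an ARBITRARY multiplier `δ`: the formal action
`T_R = exp_W(δ·log_W)` over `R = DeShalit1987.readingRing E hE` (B8a `exists_readingSeries_cm7FormalMulBy` at `c := e_K(δ)`) READ AS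
THE LUBIN–TATE ENDOMORPHISM `[δ_v]_{P′}` (`CMFormalActionLaneTransport.hom_eq_of_map_eq_of_map_eq` +
`DivisionPointsTateUnitTransport.map_hom_eq_hom_LTCoeff`), the transformation pair of `δ` and its `R`-lifts from representatives of
`δ⁻¹Λ/Λ` and the `R`-readings of the `δ`-torsion x-coordinates (`CMTransformationPairOfReps`, `s = 256`), and the series identities
`hidX`/`hidY` (B8b `cmX/cmY_identity_of_reading`).

★★★ `exists_deltaDatum_readingRing` — `∃ T Pr Qr PC QC` with the clauses hT0 · hTP (the `[c]_{P′}`-form) · hTg · hT · hQC · hQr · hPr ·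
hidX · hidY of `…SeamTateUnitOfLane.tateUnit_eq_mul_of_lane` (`s := 256`), from: the lane's `ℤ₂`-datum with its `exp`-form (`hPexp`),
`e(c) = e_K(δ)` for the unit `c` (`hce`, `hcδ`), representatives `S` of `δ⁻¹Λ/Λ`, the base points `ξ(Ω)`, `ξ(δΩ)` and `α_R = δ`,
`δ⁻¹` in `R` with their model-coordinate values, and the `δ`-torsion x-coordinates `X_c ∈ R` (`ι̂ X_c = ℘(c) − b₂/12`; their
`𝔓`-integrality is the same print as the theta datum's, II.4.9 (i) — hypotheses here).
No summit statement is proved; BSD is not proved by any of this.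

## References
* [deShalit1987] E. de Shalit, *Iwasawa theory of elliptic curves with complex multiplication* (1987), II §1.10 Lemma (p. 39),
  II §4.3 (p. 57), II §4.9 (i)(ii) (p. 62–63).
* [Cox2013] D. A. Cox, *Primes of the form x² + ny²*, 2nd ed. (2013), §10.B Thm. 10.14 (proof).
* [LubinTate1965] J. Lubin, J. Tate, *Formal complex multiplication in local fields* (1965), §1 Thm. 1.
-/

noncomputable section

open scoped Classical
open scoped NumberField PeriodPair
open PeriodPair Literature.NumberTheory.EllipticCurves Literature.NumberTheory.EllipticCurves.DeShalit1987
open NumberField Field IsDedekindDomain IsDedekindDomain.HeightOneSpectrum ValuativeRel PowerSeries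
open Literature.NumberTheory.NumberFields Literature.NumberTheory.ComplexMultiplication.EllipticUnits
open Literature.NumberTheory.GaloisRepresentations Literature.NumberTheory.GaloisRepresentations.IsNonarchimedeanLocalField
  Literature.NumberTheory.GaloisRepresentations.LubinTate _root_.WeierstrassCurve

namespace Literature.NumberTheory.EllipticCurves

attribute [local instance] ltNormUniformSpace ltNormIsUniformAddGroup rk1 nF nE fintypeResidueField

set_option maxHeartbeats 400000 in
/-- ★★★ **The `δ`-CM datum over the `𝔓`-adic reading ring** — see the module docstring.  With `R := readingRing E hE`,
`ψ := readingHom E hE`, `j := (K(𝔪_r) ⊂ K̄) ∘ subtype`, `e := (integerEquivAdicCompletionIntegers v).trans (padicIntEquivOfDegreeOne K 2 v he hf)`: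
`∃ T Pr Qr PC QC` with hT0 · hTP (`T ⊗_ψ 𝒪 = [c]_{P′} ⊗ 𝒪`) · hTg · hT · hQC · hQr · hPr · hidX · hidY (`s := 256`).  (Heartbeats raised for the
size of the statement only.) [cite: deShalit1987, II §1.10 Lemma (p. 39), II §4.9 (ii)] [cite: Cox2013, §10.B Thm. 10.14 (proof)]
[cite: LubinTate1965, §1 Thm. 1] -/
theorem exists_deltaDatum_readingRing
    -- the base field, the split prime `v ∣ 2` of degree one, the embedding
    {K : Type} [Field K] [NumberField K] {v : HeightOneSpectrum (𝓞 K)} [v.asIdeal.LiesOver (ratPlace 2).asIdeal]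
    (he : v.asIdeal.ramificationIdx (𝓞 ℚ) = 1) (hf : v.asIdeal.inertiaDeg (𝓞 ℚ) = 1) (ι : K →+* ℂ)
    -- the reading level `K(𝔪r)` and the reading field `E ⊇ e(K(𝔪r))`
    {𝔪r : Ideal (𝓞 K)}
    (E : IntermediateField (v.adicCompletion K) (AlgebraicClosure (v.adicCompletion K)))
    [FiniteDimensional (v.adicCompletion K) E]
    (hE : ∀ y : AlgebraicClosure K, y ∈ rayClassField K 𝔪r → absClosureEmbedding K (v.adicCompletion K) y ∈ E)
    -- the lane's Lubin–Tate datum (`e π = π_ℤ`, `P = [π_ℤ] = exp_W(π_ℤ·log_W)`) on `[1,−1,0,−2,−1]`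
    (hq : residueFieldCard (v.adicCompletion K) = 2) {π : 𝒪[(v.adicCompletion K)]}
    (hπ : (valuation (v.adicCompletion K)).IsUniformizer (π : (v.adicCompletion K))) {πZ : ℤ_[2]}
    (heπ : ((integerEquivAdicCompletionIntegers v).trans (padicIntEquivOfDegreeOne K 2 v he hf)) π = πZ)
    (hA : IsLTRing πZ 2) {P : PowerSeries ℤ_[2]} (hP : IsLTSeries πZ 2 P)
    (hPexp : P.map PadicInt.Coe.ringHom =
      ((⟨1, -1, 0, -2, -1⟩ : WeierstrassCurve ℤ_[2]).map PadicInt.Coe.ringHom).formalExp.subst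
        (C (πZ : ℚ_[2]) * ((⟨1, -1, 0, -2, -1⟩ : WeierstrassCurve ℤ_[2]).map PadicInt.Coe.ringHom).formalLog))
    (W : WeierstrassCurve ℤ) (hW : W = ⟨1, -1, 0, -2, -1⟩)
    -- the multiplier `δ`: its `2`-adic reading `cδ = e_K(δ) = e(c)` for a unit `c ∈ 𝒪_vˣ`
    {δ : 𝓞 K} (hδ0 : δ ≠ 0) {cδ : ℤ_[2]} (hcδ : padicEquivOfDegreeOne K 2 v he hf (algebraMap K (v.adicCompletion K) (δ : K)) = cδ)
    (c : 𝒪[(v.adicCompletion K)]ˣ)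
    (hce : ((integerEquivAdicCompletionIntegers v).trans (padicIntEquivOfDegreeOne K 2 v he hf)) (c : 𝒪[(v.adicCompletion K)]) = cδ)
    -- the model lattice (`𝒪_K`-stable), the base point `Ω` with `Ω, δΩ ∉ L ∪ ½L`, representatives `S` of `δ⁻¹Λ/Λ`
    (L : PeriodPair) {Ω : ℂ} (h₂ : L.g₂ = (W.baseChange ℂ).c₄ / 12) (h₃ : L.g₃ = (W.baseChange ℂ).c₆ / 216)
    (hCM : ∀ l ∈ L.lattice, ι (δ : K) * l ∈ L.lattice)
    (hΩL : Ω ∉ L.lattice) (hδΩL : ι (δ : K) * Ω ∉ L.lattice)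
    (h2Ω : (2 : ℂ) * Ω ∉ L.lattice) (h2Ωδ : (2 : ℂ) * (ι (δ : K) * Ω) ∉ L.lattice)
    (S : Finset ℂ) (hS0 : (0 : ℂ) ∈ S) (hS : ∀ x, ι (δ : K) * x ∈ L.lattice ↔ ∃ c' ∈ S, x - c' ∈ L.lattice)
    (hSd : ∀ c₁ ∈ S, ∀ c₂ ∈ S, c₁ - c₂ ∈ L.lattice → c₁ = c₂)
    -- the base points `ξ(Ω)`, `ξ(δΩ)`, `α_R = δ` and `δ⁻¹` over `R`, read in MODEL coordinates, and the `δ`-torsion x-coordinates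
    (x₀ y₀ x₁ y₁ αR αRinv : readingRing E hE) (hinv : αR * αRinv = 1)
    (hx₀ : algClosureEmb ι (((algebraMap (rayClassField K 𝔪r) (AlgebraicClosure K)).comp (readingRing E hE).subtype) x₀) =
      ℘[L] Ω - (W.baseChange ℂ).b₂ / 12)
    (hy₀ : algClosureEmb ι (((algebraMap (rayClassField K 𝔪r) (AlgebraicClosure K)).comp (readingRing E hE).subtype) y₀) =
      (℘'[L] Ω - (W.baseChange ℂ).a₁ * (℘[L] Ω - (W.baseChange ℂ).b₂ / 12) - (W.baseChange ℂ).a₃) / 2)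
    (hx₁ : algClosureEmb ι (((algebraMap (rayClassField K 𝔪r) (AlgebraicClosure K)).comp (readingRing E hE).subtype) x₁) =
      ℘[L] (ι (δ : K) * Ω) - (W.baseChange ℂ).b₂ / 12)
    (hy₁ : algClosureEmb ι (((algebraMap (rayClassField K 𝔪r) (AlgebraicClosure K)).comp (readingRing E hE).subtype) y₁) =
      (℘'[L] (ι (δ : K) * Ω) - (W.baseChange ℂ).a₁ * (℘[L] (ι (δ : K) * Ω) - (W.baseChange ℂ).b₂ / 12) -
        (W.baseChange ℂ).a₃) / 2)
    (hαj : algClosureEmb ι (((algebraMap (rayClassField K 𝔪r) (AlgebraicClosure K)).comp (readingRing E hE).subtype) αR) = ι (δ : K))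
    (Xc : ℂ → readingRing E hE)
    (hXc : ∀ c' ∈ S.erase 0, algClosureEmb ι (((algebraMap (rayClassField K 𝔪r) (AlgebraicClosure K)).comp (readingRing E hE).subtype)
      (Xc c')) = ℘[L] c' - (W.baseChange ℂ).b₂ / 12) :
    ∃ (T : PowerSeries (readingRing E hE)) (Pr Qr : Polynomial (readingRing E hE)) (PC QC : Polynomial ℂ),
      -- hT0
      PowerSeries.constantCoeff T = 0 ∧
      -- hTP : `T ⊗_ψ 𝒪_E = [c]_{P′} ⊗ 𝒪_E`
      T.map (readingHom E hE) = (hom (isLTRing_LTCoeff hπ)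
          (isLTSeries_map_LTCoeff_of_degree_one ((integerEquivAdicCompletionIntegers v).trans (padicIntEquivOfDegreeOne K 2 v he hf)) hq
            heπ hP)
          (isLTSeries_map_LTCoeff_of_degree_one ((integerEquivAdicCompletionIntegers v).trans (padicIntEquivOfDegreeOne K 2 v he hf)) hq
            heπ hP)
          (LTCoeff.of (v.adicCompletion K) (c : 𝒪[(v.adicCompletion K)]))).map (algebraMap (LTCoeff (v.adicCompletion K)) (unitBall E)) ∧
      -- hTg : every complex/algebraic reading of `T` is `exp_W(g(δ)·log_W)`
      (∀ (A : Type) [CommRing A] [Algebra ℚ A] (g : rayClassField K 𝔪r →+* A),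
        PowerSeries.map (g.comp (readingRing E hE).subtype) T =
          PowerSeries.subst (C (g (algebraMap K (rayClassField K 𝔪r) (δ : K))) * (⟨1, -1, 0, -2, -1⟩ : WeierstrassCurve A).formalLog)
            (⟨1, -1, 0, -2, -1⟩ : WeierstrassCurve A).formalExp) ∧
      -- hT
      (∀ z : ℂ, z ∉ L.lattice →
        algClosureEmb ι (((algebraMap (rayClassField K 𝔪r) (AlgebraicClosure K)).comp (readingRing E hE).subtype) αR) * z ∉ L.lattice →
        PC.eval (℘[L] z) =
          ℘[L] (algClosureEmb ι (((algebraMap (rayClassField K 𝔪r) (AlgebraicClosure K)).comp (readingRing E hE).subtype) αR) * z) *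
            QC.eval (℘[L] z)) ∧
      -- hQC
      (∀ z : ℂ, z ∉ L.lattice →
        algClosureEmb ι (((algebraMap (rayClassField K 𝔪r) (AlgebraicClosure K)).comp (readingRing E hE).subtype) αR) * z ∉ L.lattice →
        QC.eval (℘[L] z) ≠ 0) ∧
      -- hs
      (256 : ℂ) ≠ 0 ∧
      -- hQr
      Qr.map ((algClosureEmb ι).comp (((algebraMap (rayClassField K 𝔪r) (AlgebraicClosure K)).comp (readingRing E hE).subtype))) =
        Polynomial.C (256 : ℂ) * QC.comp (Polynomial.X + Polynomial.C ((W.baseChange ℂ).b₂ / 12)) ∧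
      -- hPr
      Pr.map ((algClosureEmb ι).comp (((algebraMap (rayClassField K 𝔪r) (AlgebraicClosure K)).comp (readingRing E hE).subtype))) =
        Polynomial.C (256 : ℂ) * (PC.comp (Polynomial.X + Polynomial.C ((W.baseChange ℂ).b₂ / 12)) -
          Polynomial.C ((W.baseChange ℂ).b₂ / 12) * QC.comp (Polynomial.X + Polynomial.C ((W.baseChange ℂ).b₂ / 12))) ∧
      -- hidX
      ((((W.map (Int.castRingHom (readingRing E hE))).translateX x₁ y₁).subst T + C (0 : readingRing E hE)) *
          Polynomial.aeval ((W.map (Int.castRingHom (readingRing E hE))).translateX x₀ y₀ + C (0 : readingRing E hE)) Qr =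
        Polynomial.aeval ((W.map (Int.castRingHom (readingRing E hE))).translateX x₀ y₀ + C (0 : readingRing E hE)) Pr) ∧
      -- hidY
      (C αR * (2 * PowerSeries.subst T ((W.map (Int.castRingHom (readingRing E hE))).translateY x₁ y₁) +
              C (W.map (Int.castRingHom (readingRing E hE))).a₁ *
                PowerSeries.subst T ((W.map (Int.castRingHom (readingRing E hE))).translateX x₁ y₁) +
              C (W.map (Int.castRingHom (readingRing E hE))).a₃) *
            Polynomial.aeval ((W.map (Int.castRingHom (readingRing E hE))).translateX x₀ y₀ + C (0 : readingRing E hE)) Qr +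
          (PowerSeries.subst T ((W.map (Int.castRingHom (readingRing E hE))).translateX x₁ y₁) + C (0 : readingRing E hE)) *
            Polynomial.aeval ((W.map (Int.castRingHom (readingRing E hE))).translateX x₀ y₀ + C (0 : readingRing E hE))
              (Polynomial.derivative Qr) *
            (2 * (W.map (Int.castRingHom (readingRing E hE))).translateY x₀ y₀ +
              C (W.map (Int.castRingHom (readingRing E hE))).a₁ * (W.map (Int.castRingHom (readingRing E hE))).translateX x₀ y₀ +
              C (W.map (Int.castRingHom (readingRing E hE))).a₃) =
        Polynomial.aeval ((W.map (Int.castRingHom (readingRing E hE))).translateX x₀ y₀ + C (0 : readingRing E hE))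
            (Polynomial.derivative Pr) *
          (2 * (W.map (Int.castRingHom (readingRing E hE))).translateY x₀ y₀ +
            C (W.map (Int.castRingHom (readingRing E hE))).a₁ * (W.map (Int.castRingHom (readingRing E hE))).translateX x₀ y₀ +
            C (W.map (Int.castRingHom (readingRing E hE))).a₃)) := by
  classical
  subst hW
  -- ### the model `[1,−1,0,−2,−1]` over `ℂ`
  have hbc : ((⟨1, -1, 0, -2, -1⟩ : WeierstrassCurve ℤ).baseChange ℂ) = (⟨1, -1, 0, -2, -1⟩ : WeierstrassCurve ℂ) :=
    cm7Model_map _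
  have hb12 : (⟨1, -1, 0, -2, -1⟩ : WeierstrassCurve ℂ).b₂ / 12 = -1 / 4 := cm7Model_b₂_div_twelve
  have hb12' : (⟨1, -1, 0, -2, -1⟩ : WeierstrassCurve ℂ).b₂ / 12 = -(1 / 4) := by rw [hb12]; ring
  have hg₂ : L.g₂ = 35 / 4 := by rw [h₂, hbc, cm7Model_c₄_div_twelve]
  have hg₃ : L.g₃ = 49 / 8 := by rw [h₃, hbc, cm7Model_c₆_div]
  have h₂' : L.g₂ = (⟨1, -1, 0, -2, -1⟩ : WeierstrassCurve ℂ).c₄ / 12 := by rw [h₂, hbc]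
  have h₃' : L.g₃ = (⟨1, -1, 0, -2, -1⟩ : WeierstrassCurve ℂ).c₆ / 216 := by rw [h₃, hbc]
  have hx₀c := hx₀; have hy₀c := hy₀; have hx₁c := hx₁; have hy₁c := hy₁
  rw [hbc] at hx₀c hy₀c hx₁c hy₁c
  have hΩ' : ℘'[L] Ω ≠ 0 := L.derivWeierstrassP_ne_zero hΩL h2Ω
  have hαΩ' : ℘'[L] (ι (δ : K) * Ω) ≠ 0 := L.derivWeierstrassP_ne_zero hδΩL h2Ωδ
  have hα0 : ι (δ : K) ≠ 0 := (map_ne_zero ι).mpr (by exact_mod_cast hδ0)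
  -- ### the reading `φ = ι̂ ∘ j` is injective; `φ αR = ι δ`
  set φ : readingRing E hE →+* ℂ :=
    (algClosureEmb ι).comp ((algebraMap (rayClassField K 𝔪r) (AlgebraicClosure K)).comp (readingRing E hE).subtype) with hφdef
  have hφ : Function.Injective φ :=
    (algClosureEmb ι).injective.comp ((algebraMap (rayClassField K 𝔪r) (AlgebraicClosure K)).injective.comp Subtype.val_injective)
  have hα : φ αR = ι (δ : K) := hαj
  -- ### the formal CM action `T = exp_W(δ·log_W)` over `R` (B8a), read as `[c]_{P′}`
  obtain ⟨Pδ, hPδ⟩ := ((⟨1, -1, 0, -2, -1⟩ : WeierstrassCurve ℤ_[2])).exists_map_eq_formalExp_subst_C_mul_formalLog cδ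
  have hTex := exists_readingSeries_cm7FormalMulBy he hf E hE hPδ (δ : K) hcδ
  have hT0 := hTex.choose_spec.1
  have hTψ := hTex.choose_spec.2.2.1
  have hTg := hTex.choose_spec.2.2.2
  have hhom : hom hA hP hP cδ = Pδ := hom_eq_of_map_eq_of_map_eq _ hA hP hPexp hPδ
  have hTP : (hTex.choose).map (readingHom E hE) = (hom (isLTRing_LTCoeff hπ)
      (isLTSeries_map_LTCoeff_of_degree_one ((integerEquivAdicCompletionIntegers v).trans (padicIntEquivOfDegreeOne K 2 v he hf)) hq
        heπ hP)
      (isLTSeries_map_LTCoeff_of_degree_one ((integerEquivAdicCompletionIntegers v).trans (padicIntEquivOfDegreeOne K 2 v he hf)) hq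
        heπ hP)
      (LTCoeff.of (v.adicCompletion K) (c : 𝒪[(v.adicCompletion K)]))).map (algebraMap (LTCoeff (v.adicCompletion K)) (unitBall E)) := by
    rw [hTψ, ← hhom, map_hom_eq_hom_LTCoeff _ hq hπ heπ hA hP cδ, ← hce, RingEquiv.symm_apply_apply]
  have hgδ : ((algClosureEmb ι).comp (algebraMap (rayClassField K 𝔪r) (AlgebraicClosure K)))
      (algebraMap K (rayClassField K 𝔪r) (δ : K)) = ι (δ : K) := by
    rw [RingHom.comp_apply, ← IsScalarTower.algebraMap_apply, algClosureEmb_algebraMap]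
  have hTφ : PowerSeries.map φ hTex.choose =
      PowerSeries.subst (C (φ αR) * (⟨1, -1, 0, -2, -1⟩ : WeierstrassCurve ℂ).formalLog) (⟨1, -1, 0, -2, -1⟩ : WeierstrassCurve ℂ).formalExp := by
    have h := hTg ℂ ((algClosureEmb ι).comp (algebraMap (rayClassField K 𝔪r) (AlgebraicClosure K)))
    rw [hgδ, RingHom.comp_assoc] at h
    rw [hα]
    exact h
  -- ### the transformation pair of `δ` from the representatives and its `R`-lifts (TP-δ)
  have hE' : ∀ c' ∈ S.erase 0, (fun c' => φ (Xc c')) c' = ℘[L] c' + 1 / 4 := fun c' hc' => by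
    show φ (Xc c') = _
    have h := hXc c' hc'
    rw [hbc, hb12] at h
    rw [show φ (Xc c') = algClosureEmb ι (((algebraMap (rayClassField K 𝔪r) (AlgebraicClosure K)).comp (readingRing E hE).subtype)
      (Xc c')) from rfl, h]
    ring
  obtain ⟨hTC, hQCC, hrecQ, hrecP⟩ := L.transformationPair_of_reps hg₂ hg₃ hα0 hCM hS0 hS hSd hE' (Pn := _) (Q := _) (P := _)
    rfl rfl rfl
  obtain ⟨hQrm, hPrm⟩ := map_transformationLifts φ (fun c' => Xc c') hα hinv (Qr := _) (Pr := _) rfl rfl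
  -- `hQr` / `hPr` in the seam's re-centred shape (`b₂/12 = −1/4`, `s = 256`)
  have hQr : Polynomial.map φ (Polynomial.C (256 : readingRing E hE) * ∏ c' ∈ S.erase 0, (Polynomial.X - Polynomial.C (Xc c')) ^ 2) =
      Polynomial.C (256 : ℂ) * (∏ c' ∈ S.erase 0, (Polynomial.X - Polynomial.C (℘[L] c')) ^ 2 : Polynomial ℂ).comp
        (Polynomial.X + Polynomial.C ((⟨1, -1, 0, -2, -1⟩ : WeierstrassCurve ℂ).b₂ / 12)) := by
    rw [hb12', hrecQ]; exact hQrm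
  have hPr := hPrm
  rw [← hrecP, ← hb12'] at hPr
  -- ### the series identities over `R` (B8b), with `φ αR` in place of `ι δ`
  have hx₁' : φ x₁ = ℘[L] (φ αR * Ω) - (⟨1, -1, 0, -2, -1⟩ : WeierstrassCurve ℂ).b₂ / 12 := by rw [hα]; exact hx₁c
  have hy₁' : φ y₁ = (℘'[L] (φ αR * Ω) - (⟨1, -1, 0, -2, -1⟩ : WeierstrassCurve ℂ).a₁ * (℘[L] (φ αR * Ω) -
      (⟨1, -1, 0, -2, -1⟩ : WeierstrassCurve ℂ).b₂ / 12) - (⟨1, -1, 0, -2, -1⟩ : WeierstrassCurve ℂ).a₃) / 2 := by rw [hα]; exact hy₁c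
  have hαΩL : φ αR * Ω ∉ L.lattice := by rw [hα]; exact hδΩL
  have hαΩ'' : ℘'[L] (φ αR * Ω) ≠ 0 := by rw [hα]; exact hαΩ'
  have hidX := cmX_identity_of_reading φ hφ L (256 : ℂ) x₀ y₀ x₁ y₁ αR hTex.choose hT0 _ _ h₂' h₃'
    (fun z hz h => by rw [hα] at h ⊢; exact hTC z hz h) hΩL hαΩL hx₀c hy₀c hx₁' hy₁' hTφ hQr hPr
  have hidY := cmY_identity_of_reading φ hφ L (256 : ℂ) x₀ y₀ x₁ y₁ αR hTex.choose hT0 _ _ h₂' h₃'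
    (fun z hz h => by rw [hα] at h ⊢; exact hTC z hz h) hΩL hαΩL hΩ' hαΩ'' hx₀c hy₀c hx₁' hy₁' hTφ hQr hPr
  -- ### assembly
  refine ⟨hTex.choose, ?_, ?_, ?_, ?_, hT0, hTP, hTg, fun z hz h => ?_, fun z hz h => ?_, by norm_num, ?_, ?_, ?_, ?_⟩
  rotate_left 4
  · rw [hαj] at h ⊢
    exact hTC z hz h
  · rw [hαj] at h
    exact hQCC z hz h
  · rw [hbc]
    exact hQr
  · rw [hbc]
    exact hPr
  · exact (cm7Model_eq_map_intCast (A := readingRing E hE)) ▸ hidX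
  · exact (cm7Model_eq_map_intCast (A := readingRing E hE)) ▸ hidY

end Literature.NumberTheory.EllipticCurves

end
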